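import Summits.Ventures.Crystal3D.Theorems.StickyWulffConstantCoaxialWallLawBarlowTailDefs
import Literature.MathematicalPhysics.StatisticalMechanics.BarlowCoordination
import HarnessLib

/-!
# Definitions: the COAXIAL MODULE and the universe of coaxial module windows (lane F's non-Barlow coaxial universe)

HONEST FRAMING. Venture `Summits/Ventures/Crystal3D` (cell `crystal3d-full`), crux `CoaxialWallLaw`
(stmt-Ventures-19481, `route-Ventures-StickyWulffConstant`), REGISTERED line `WallLedgerF` (planner cf-p1), open stub
`stub_coaxialTwoSlabAdhesion`.  DEFINITIONS ONLY; nothing is claimed; F-C1 not moved.  19481-p1 g13 TAIL AUDIT part 2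
(2026-08-29): after cf-p1 DECISIONS (xlviii)/(liv) the Barlow side of the typed tail is closed (outer-shell lemma p675274 /
p676505, inner-universe branch-and-bound certificate, 19481-p2's flat bridge), and the typed residual is the NON-BARLOW tail over
`barlowWindowUniverseAll`.  The coaxial non-Barlow structures met by the lane (coherent Σ3 twins with risers of any
height and registry, kinks, islands, stacking-fault translation domains, the `{112}` incoherent wall) all live on ONE
lattice: every ball sits on a common basal layer plane at an `A/B/C` in-plane position.  This file names that lattice and
the corresponding window universe, so that a single certificate object can subsume U-W and every riser skeleton.

* `coaxialModule a h` — the rank-3 lattice `{i•u + j•v + n•w + k•(h e₃) : i j n k ∈ ℤ}` generated by the triangular layer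
  lattice, the hole offset `w = (u+v)/3` and the layer normal: ALL three letters in EVERY layer.  Its distance-`a` pairs
  are the eighteen-vector menu `D₊ ∪ D₋`; in-layer hole neighbours (`a/√3`) and vertical pairs (`h`) are closer than `a`,
  so its `a`-separated subsets are exactly the coaxial two- or multi-domain configurations;
* `barlowStacking_subset_coaxialModule` — every Barlow stacking (any Hägg word) lies on the module;
* `coaxialModuleUniverse` (𝒰_cx) — payer windows ON THE MODULE: `P ⊆ coaxialModule 1 √(2/3) ∩ B̄(0,3]`, `1`-separated,
  `0 ∈ P`, `deg_P 0 ≤ 11`; `mem_coaxialModuleUniverse_of_barlowWindow` / `barlowWindowUniverseAll_subset_coaxialModuleUniverse`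
  — U-W(`vmax`) and the `vmax`-free Barlow universe are contained in it;
* `endRowOnSiteFlatA_anti` — the flat on-site fact is antitone in the universe, so a certificate for
  `EndRowOnSiteFlatA v2 (9/2) coaxialModuleUniverse` (branch-and-bound with exclusion constraints over the module sites of
  the window — PREREG-F-CERT §13 (C)) implies the Barlow ones of record.
WHAT THIS IS NOT: no census fact; no bridge on module windows (the frame lemma / domination of `…OnSiteDominate` are stated
on Barlow windows; their module-window form is the next typed step); the residual tail «a ball OFF the module within `3` of
the payer» (foreign balls / disordered hosts, cf-p1 (xlix) R2) is not addressed; F-C1 not moved.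
-/

noncomputable section

namespace Summit.Ventures.Crystal3D.Theorems

open Summit.Ventures.Crystal3D Finset
open Literature.MathematicalPhysics.StatisticalMechanics (barlowPos barlowStacking IsHaggSeq haggLabel triangularVec₁
  triangularVec₂ barlowOffset layerNormal le_dist_of_mem_barlowStacking_ideal)
open scoped InnerProductSpace

/-- **THE COAXIAL MODULE** with in-layer spacing `a` and layer spacing `h`: the lattice
`{i•u + j•v + n•w + k•(h e₃) : i, j, n, k ∈ ℤ}` — all three letter positions `A/B/C` in every basal layer. -/
def coaxialModule (a h : ℝ) : Set (EuclideanSpace ℝ (Fin 3)) :=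
  {x | ∃ i j n k : ℤ, x = (i : ℝ) • triangularVec₁ a + (j : ℝ) • triangularVec₂ a + (n : ℝ) • barlowOffset a +
    (k : ℝ) • layerNormal h}

/-- Every Barlow stacking (any label sequence `s`) lies on the coaxial module. -/
theorem barlowStacking_subset_coaxialModule (a h : ℝ) (s : ℤ → ℤ) : barlowStacking a h s ⊆ coaxialModule a h := by
  rintro x ⟨k, i, j, rfl⟩
  exact ⟨i, j, haggLabel s k, k, rfl⟩

open scoped Classical in
/-- **THE UNIVERSE OF COAXIAL MODULE WINDOWS** 𝒰_cx (ideal spacings `a = 1`, `h = √(2/3)`): finite `1`-separated subsets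
of the module inside the closed ball `B̄(0, 3]`, containing the payer `0` with `deg 0 ≤ 11`.  Contains every Barlow payer
window (`barlowWindowUniverseAll_subset_coaxialModuleUniverse`) and every coherent-twin / fault / riser / kink / island /
`{112}`-wall window of the lane's skeleton list. -/
def coaxialModuleUniverse : Set (Finset (EuclideanSpace ℝ (Fin 3))) :=
  {P | (↑P : Set (EuclideanSpace ℝ (Fin 3))) ⊆ coaxialModule 1 (Real.sqrt (2 / 3)) ∩ Metric.closedBall 0 3 ∧
    (∀ p ∈ P, ∀ q ∈ P, p ≠ q → (1 : ℝ) ≤ dist p q) ∧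
    (0 : EuclideanSpace ℝ (Fin 3)) ∈ P ∧ (P.filter fun q => dist (0 : EuclideanSpace ℝ (Fin 3)) q = 1).card ≤ 11}

/-- A U-W(`vmax`) pattern is a coaxial module window. -/
theorem mem_coaxialModuleUniverse_of_barlowWindow {vmax : ℕ} {P : Finset (EuclideanSpace ℝ (Fin 3))}
    (h : P ∈ barlowWindowUniverse vmax) : P ∈ coaxialModuleUniverse := by
  obtain ⟨s, hs, V, -, -, hP, h0, hdeg⟩ := h
  have hsub : (↑P : Set (EuclideanSpace ℝ (Fin 3))) ⊆ barlowStacking 1 (Real.sqrt (2 / 3)) s ∩ Metric.closedBall 0 3 := by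
    rw [hP]; exact fun x hx => hx.1
  refine ⟨fun x hx => ⟨barlowStacking_subset_coaxialModule _ _ _ (hsub hx).1, (hsub hx).2⟩, ?_, h0, hdeg⟩
  intro p hp q hq hpq
  have hh : Real.sqrt (2 / 3) ^ 2 = 2 / 3 * (1 : ℝ) ^ 2 := by rw [Real.sq_sqrt (by norm_num)]; ring
  exact le_dist_of_mem_barlowStacking_ideal hs one_pos hh (hsub (mem_coe.2 hp)).1 (hsub (mem_coe.2 hq)).1 hpq

/-- The `vmax`-free Barlow universe is contained in 𝒰_cx. -/
theorem barlowWindowUniverseAll_subset_coaxialModuleUniverse : barlowWindowUniverseAll ⊆ coaxialModuleUniverse := by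
  intro P hP
  obtain ⟨n, hn⟩ := Set.mem_iUnion.1 hP
  exact mem_coaxialModuleUniverse_of_barlowWindow hn

/-- The inner Barlow universe is contained in 𝒰_cx. -/
theorem barlowInnerUniverse_subset_coaxialModuleUniverse : barlowInnerUniverse ⊆ coaxialModuleUniverse := by
  intro P hP
  obtain ⟨s, hs, V, hV, hP', h0, hdeg⟩ := hP
  exact mem_coaxialModuleUniverse_of_barlowWindow (vmax := V.card)
    ⟨s, hs, V, le_rfl, fun x hx => (hV hx).1, hP', h0, hdeg⟩

/-- The flat on-site fact is ANTITONE in the universe: a certificate on a larger universe serves every smaller one. -/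
theorem endRowOnSiteFlatA_anti {v : WordVersion} {sF : ℝ} {𝒰 𝒰' : Set (Finset (EuclideanSpace ℝ (Fin 3)))}
    (h𝒰 : 𝒰 ⊆ 𝒰') (h : EndRowOnSiteFlatA v sF 𝒰') : EndRowOnSiteFlatA v sF 𝒰 :=
  fun P hP => h P (h𝒰 hP)

/-- In particular a 𝒰_cx certificate gives the inner-universe fact of record (cf-p1 (liv)). -/
theorem endRowOnSiteFlatA_inner_of_coaxialModule {v : WordVersion} {sF : ℝ}
    (h : EndRowOnSiteFlatA v sF coaxialModuleUniverse) : EndRowOnSiteFlatA v sF barlowInnerUniverse :=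
  endRowOnSiteFlatA_anti barlowInnerUniverse_subset_coaxialModuleUniverse h

end Summit.Ventures.Crystal3D.Theorems

end
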